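import Summits.CriticalPhenomena.PercolationContinuityZ3.Theorems.PercNearOneGluingNoHeavyLowerTailLonelyRelay
import Literature.Probability.Percolation.TwoSetConditionalAssociation
import Literature.Probability.Percolation.TripodExchange
import HarnessLib

/-!
# `NoHeavyLowerTail` (stmt-CriticalPhenomena-4575) — the GUARDED lonely relay lemma
# (Kozma–Nitzan Lemma 1(ii) + Lemma 2, singleton blocks with increasing guards)

For bond percolation `μ = prodBernoulli w` on `Fin n`, an observer `o`, a relay set `A`, and for every relay
`x ∈ A` an INCREASING event `Q_x` determined by the open cluster of the other relays `A ∖ x`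
(formally: `1_{Q_x}(ω) = G_x(⋃_{t ∈ A∖x} C_t(ω))` for a monotone `G_x : Set (Sym2 (Fin n)) → ℝ`), write
`D_x = {x ↮ A ∖ x}`.  Then

  `Σ_{x ∈ A} μ({o ↔ x} ∩ D_x ∩ Q_x) ≤ max_{x ∈ A} μ(D_x ∩ Q_x)`            (`guardedLonelyRelay`)

(stated with a common bound `t`).  With `Q_x = everything` this is the lonely relay lemma
`Theorems.lonelyRelay` (KN Lemma 2); the guards are what the cumulative isolation lemma (registered stub
`stub_cumulativeIsolation`, crux evidence `CIL.md`) needs at level `j = 2`: e.g. `Q_x = {A ∖ x is connected}`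
gives `Σ_x P(C(o) ∩ A = {x}, A ∖ x connected) ≤ max_x P(the relay partition is (A∖x | x))`
(file `…CILFour`).  Mechanism, for each `x`:
* KN Lemma 1(ii) = van den Berg–Häggström–Kahn Thm 1.5 for the vertex sets `{x}`, `A∖x` in the negatively
  correlated form (`BHK2006_twoSetConditionalAssociation.negCorrelation`, functions `1{o ∈ C_x}` and `G_x`):
  `μ(D_x) μ({o↔x} ∩ D_x ∩ Q_x) ≤ μ({o↔x} ∩ D_x) μ(D_x ∩ Q_x)`                    (`negCorr`);
* KN Lemma 1(i) = terminal separation (`stub_terminalSeparation`, BHK Thm 1.3):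
  `μ({o↔x} ∩ D_x) μ(M) ≤ μ(D_x) μ({o↔x} ∩ M)`, `M = {A pairwise separated}`        (`termSep`);
* the events `{o ↔ x} ∩ M` are pairwise disjoint, so `Σ_x μ({o↔x} ∩ M) ≤ μ(M)`; divide by `μ(M) > 0`
  (`guardedLonelyRelay_of_pos`), and remove `μ(M) = 0` by scaling the weights (`stub_weightContinuity`),
  exactly as in `Theorems.blockLonelyRelay`.
-/

noncomputable section

namespace Summit.CriticalPhenomena.PercolationContinuityZ3.Theorems

open scoped BigOperators Classical Topology
open MeasureTheory Set Filter
open Literature.Probability.LatticeModels (prodBernoulli)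
open Literature.Probability.Percolation

variable {n : ℕ}

namespace GuardedLonelyRelay

/-- **KN Lemma 1(i) instance (terminal separation).**  `μ({o↔x} ∩ D_x) μ(M) ≤ μ(D_x) μ({o↔x} ∩ M)` with
`D_x = {x ↮ A∖x}` and `M = {A pairwise separated}` (`x ∈ A`).
[cite: KozmaNitzan2024, Lemma 1(i) (p. 5); VandenbergHaggstromKahn2005, Thm. 1.3] -/
theorem termSep (w : Sym2 (Fin n) → unitInterval) (A : Finset (Fin n)) (o : Fin n) {x : Fin n}
    (hx : x ∈ A) :
    (prodBernoulli w).real (openConn o x ∩ {ω | ∀ t ∈ A.erase x, ω ∉ openConn x t}) *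
        (prodBernoulli w).real {ω : BondConfig (Fin n) | ∀ a ∈ A, ∀ a' ∈ A, a ≠ a' → ω ∉ openConn a a'} ≤
      (prodBernoulli w).real {ω | ∀ t ∈ A.erase x, ω ∉ openConn x t} *
        (prodBernoulli w).real (openConn o x ∩
          {ω : BondConfig (Fin n) | ∀ a ∈ A, ∀ a' ∈ A, a ≠ a' → ω ∉ openConn a a'}) := by
  have key := stub_terminalSeparation
    (fun n w s X F G hF hG hs => BHK2006_clusterConditionalPositiveAssociation_holds (Fin n) w s X F G hF hG hs)
    n w (A.erase x) o x
  rw [singleFinger_sep_inter_pairSep_eq A hx] at key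
  exact key

omit n in
/-- Reachability from `t` in the open graph is reachability inside the open edge cluster `C_t`. [folklore] -/
theorem reachable_fromEdgeSet_openEdgeCluster {V : Type*} {ω : BondConfig V} {t v : V}
    (h : (openGraph ω).Reachable t v) :
    (SimpleGraph.fromEdgeSet (openEdgeCluster ω t)).Reachable t v := by
  have H : ∀ {u u' : V} (q : (openGraph ω).Walk u u'), (openGraph ω).Reachable t u →
      (SimpleGraph.fromEdgeSet (openEdgeCluster ω t)).Reachable u u' := by
    intro u u' q
    induction q with
    | nil => exact fun _ => SimpleGraph.Reachable.refl _
    | cons hadj q ih =>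
      rename_i a b c
      intro hu
      have hadj' := (openGraph_adj ω a b).1 hadj
      have hu' : (openGraph ω).Reachable t b := hu.trans hadj.reachable
      have hmem : s(a, b) ∈ openEdgeCluster ω t := by
        refine (mem_openEdgeCluster_iff ω t _).2 ⟨hadj'.1, ?_, fun v hv => ?_⟩
        · rw [Sym2.mk_isDiag_iff]; exact hadj'.2
        · rcases Sym2.mem_iff.1 hv with rfl | rfl
          · exact hu
          · exact hu'
      have hstep : (SimpleGraph.fromEdgeSet (openEdgeCluster ω t)).Adj a b :=
        (SimpleGraph.fromEdgeSet_adj _).2 ⟨hmem, hadj'.2⟩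
      exact hstep.reachable.trans (ih hu')
  obtain ⟨p⟩ := h
  exact H p (SimpleGraph.Reachable.refl t)

omit n in
/-- The indicator of "the set `T` is internally connected" as a monotone function of an edge set:
`G_T(C) = 1` iff all points of `T` are joined inside the graph with edge set `C`. [folklore] -/
theorem connAllFn_monotone {V : Type*} (T : Set V) :
    Monotone fun C : Set (Sym2 V) =>
      (if ∀ t ∈ T, ∀ t' ∈ T, (SimpleGraph.fromEdgeSet C).Reachable t t' then (1 : ℝ) else 0) := by
  intro C C' hCC'
  dsimp only
  by_cases h : ∀ t ∈ T, ∀ t' ∈ T, (SimpleGraph.fromEdgeSet C).Reachable t t'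
  · rw [if_pos h, if_pos (fun t ht t' ht' => (h t ht t' ht').mono (SimpleGraph.fromEdgeSet_mono hCC'))]
  · rw [if_neg h]; split_ifs <;> norm_num

omit n in
/-- Evaluated at the union of the open edge clusters of `T`, `G_T` is the indicator of
`{T pairwise joined}`. [folklore] -/
theorem connAllFn_biUnion_openEdgeCluster {V : Type*} (T : Set V) (ω : BondConfig V) :
    (if ∀ t ∈ T, ∀ t' ∈ T,
        (SimpleGraph.fromEdgeSet (⋃ s ∈ T, openEdgeCluster ω s)).Reachable t t' then (1 : ℝ) else 0) =
      ({ω' : BondConfig V | ∀ t ∈ T, ∀ t' ∈ T, ω' ∈ openConn t t'}).indicator 1 ω := by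
  by_cases h : ∀ t ∈ T, ∀ t' ∈ T, ω ∈ (openConn t t' : Set (BondConfig V))
  · rw [indicator_of_mem (show ω ∈ {ω' : BondConfig V | ∀ t ∈ T, ∀ t' ∈ T, ω' ∈ openConn t t'} from h),
      Pi.one_apply, if_pos]
    intro t ht t' ht'
    have htt' : (openGraph ω).Reachable t t' := h t ht t' ht'
    exact (reachable_fromEdgeSet_openEdgeCluster htt').mono
      (SimpleGraph.fromEdgeSet_mono (Set.subset_biUnion_of_mem ht))
  · rw [indicator_of_notMem (show ω ∉ {ω' : BondConfig V | ∀ t ∈ T, ∀ t' ∈ T, ω' ∈ openConn t t'} from h),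
      if_neg]
    intro h'
    apply h
    intro t ht t' ht'
    have hsub : (⋃ s ∈ T, openEdgeCluster ω s) ⊆ ω :=
      Set.iUnion₂_subset fun s _ => openEdgeCluster_subset ω s
    have := (h' t ht t' ht').mono (SimpleGraph.fromEdgeSet_mono hsub)
    exact this

/-- **KN Lemma 1(ii) instance (negative correlation across `{x ↮ A∖x}`).**  For an increasing event `Q`
determined by the cluster of `A ∖ x` (through a monotone `G`):
`μ(D_x) μ({o↔x} ∩ D_x ∩ Q) ≤ μ({o↔x} ∩ D_x) μ(D_x ∩ Q)`.
[cite: KozmaNitzan2024, Lemma 1(ii) (p. 5); VandenbergHaggstromKahn2005, Thm. 1.5 (sets)] -/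
theorem negCorr (w : Sym2 (Fin n) → unitInterval) (A : Finset (Fin n)) (o x : Fin n)
    (Q : Set (BondConfig (Fin n))) (G : Set (Sym2 (Fin n)) → ℝ) (hG : Monotone G)
    (hGQ : ∀ ω, G (⋃ t ∈ (↑(A.erase x) : Set (Fin n)), openEdgeCluster ω t) = Q.indicator 1 ω) :
    (prodBernoulli w).real {ω | ∀ t ∈ A.erase x, ω ∉ openConn x t} *
        (prodBernoulli w).real (openConn o x ∩ {ω | ∀ t ∈ A.erase x, ω ∉ openConn x t} ∩ Q) ≤
      (prodBernoulli w).real (openConn o x ∩ {ω | ∀ t ∈ A.erase x, ω ∉ openConn x t}) *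
        (prodBernoulli w).real ({ω | ∀ t ∈ A.erase x, ω ∉ openConn x t} ∩ Q) := by
  have key := BHK2006_twoSetConditionalAssociation.negCorrelation w ({x} : Set (Fin n))
    (↑(A.erase x) : Set (Fin n)) (connIndicatorFn x o) G (monotone_connIndicatorFn x o) hG
  have hD : {ω : BondConfig (Fin n) | ∀ s ∈ ({x} : Set (Fin n)), ∀ t ∈ (↑(A.erase x) : Set (Fin n)),
      ¬ (openGraph ω).Reachable s t} = {ω | ∀ t ∈ A.erase x, ω ∉ openConn x t} := by
    ext ω
    simp only [mem_setOf_eq, mem_singleton_iff, forall_eq, Finset.mem_coe]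
    rfl
  have hF : ∀ ω : BondConfig (Fin n),
      connIndicatorFn x o (⋃ s ∈ ({x} : Set (Fin n)), openEdgeCluster ω s) =
        (openConn x o : Set (BondConfig (Fin n))).indicator 1 ω := fun ω => by
    rw [biUnion_singleton]; exact connIndicatorFn_openEdgeCluster ω x o
  simp only [hD, hF, hGQ] at key
  rw [TripodExchange.setIntegral_indicator_mul_indicator_eq, TripodExchange.setIntegral_indicator_one_eq,
    TripodExchange.setIntegral_indicator_one_eq] at key
  have hox : (openConn o x : Set (BondConfig (Fin n))) = openConn x o := by
    ext ω; exact SimpleGraph.reachable_comm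
  have e1 : (openConn o x ∩ {ω | ∀ t ∈ A.erase x, ω ∉ openConn x t} ∩ Q : Set (BondConfig (Fin n))) =
      {ω | ∀ t ∈ A.erase x, ω ∉ openConn x t} ∩ (openConn x o ∩ Q) := by
    rw [hox, inter_comm (openConn x o), inter_assoc]
  have e2 : (openConn o x ∩ {ω | ∀ t ∈ A.erase x, ω ∉ openConn x t} : Set (BondConfig (Fin n))) =
      {ω | ∀ t ∈ A.erase x, ω ∉ openConn x t} ∩ openConn x o := by
    rw [hox, inter_comm]
  rw [e1, e2]
  exact key

/-- The events `{o ↔ x} ∩ D_x ∩ Q_x` lie in `D_x`. -/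
theorem guarded_subset (o x : Fin n) (A : Finset (Fin n)) (Q : Set (BondConfig (Fin n))) :
    (openConn o x ∩ {ω | ∀ t ∈ A.erase x, ω ∉ openConn x t} ∩ Q : Set (BondConfig (Fin n))) ⊆
      {ω | ∀ t ∈ A.erase x, ω ∉ openConn x t} :=
  fun _ hω => hω.1.2

/-- **Guarded lonely relay bound when `μ(M) > 0`.** [cite: KozmaNitzan2024, Lemmas 1–2 (pp. 5–6)] -/
theorem guardedLonelyRelay_of_pos (w : Sym2 (Fin n) → unitInterval) (A : Finset (Fin n)) (o : Fin n)
    (Q : Fin n → Set (BondConfig (Fin n)))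
    (hQ : ∀ x ∈ A, ∃ G : Set (Sym2 (Fin n)) → ℝ, Monotone G ∧
      ∀ ω, G (⋃ t ∈ (↑(A.erase x) : Set (Fin n)), openEdgeCluster ω t) = (Q x).indicator 1 ω)
    (t : ℝ) (ht : 0 ≤ t)
    (hq : ∀ x ∈ A, (prodBernoulli w).real ({ω | ∀ t ∈ A.erase x, ω ∉ openConn x t} ∩ Q x) ≤ t)
    (hM : 0 < (prodBernoulli w).real
      {ω : BondConfig (Fin n) | ∀ a ∈ A, ∀ a' ∈ A, a ≠ a' → ω ∉ openConn a a'}) :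
    ∑ x ∈ A, (prodBernoulli w).real
        (openConn o x ∩ {ω | ∀ t ∈ A.erase x, ω ∉ openConn x t} ∩ Q x) ≤ t := by
  set μ := prodBernoulli w with hμ
  set M : Set (BondConfig (Fin n)) := {ω | ∀ a ∈ A, ∀ a' ∈ A, a ≠ a' → ω ∉ openConn a a'} with hMdef
  -- termwise: `μ(G_x) μ(M) ≤ t μ({o↔x} ∩ M)`
  have h2 : ∀ x ∈ A,
      μ.real (openConn o x ∩ {ω | ∀ t ∈ A.erase x, ω ∉ openConn x t} ∩ Q x) * μ.real M ≤
        t * μ.real (openConn o x ∩ M) := by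
    intro x hx
    obtain ⟨G, hG, hGQ⟩ := hQ x hx
    have hneg := negCorr w A o x (Q x) G hG hGQ
    have hsep := termSep w A o hx
    have hqx := hq x hx
    set Dx : Set (BondConfig (Fin n)) := {ω | ∀ t ∈ A.erase x, ω ∉ openConn x t} with hDx
    set g := μ.real (openConn o x ∩ Dx ∩ Q x) with hg
    set d := μ.real Dx with hd
    set e := μ.real (openConn o x ∩ Dx) with he
    set hq' := μ.real (Dx ∩ Q x) with hhq
    set m := μ.real M with hm
    set f := μ.real (openConn o x ∩ M) with hf
    have hg0 : 0 ≤ g := measureReal_nonneg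
    have hm0 : 0 ≤ m := measureReal_nonneg
    have hf0 : 0 ≤ f := measureReal_nonneg
    have he0 : 0 ≤ e := measureReal_nonneg
    have hgd : g ≤ d := measureReal_mono (guarded_subset o x A (Q x))
    rcases (measureReal_nonneg : 0 ≤ d).eq_or_lt with hd0 | hdpos
    · -- `μ(D_x) = 0`: then `μ(G_x) = 0`
      have hg' : g = 0 := le_antisymm (hd0 ▸ hgd) hg0
      rw [hg', zero_mul]
      exact mul_nonneg ht hf0
    · -- `d g ≤ e hq' ≤ e t` and `e m ≤ d f`
      have h1 : d * g * m ≤ e * t * m := by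
        have : d * g ≤ e * t := hneg.trans (mul_le_mul_of_nonneg_left hqx he0)
        exact mul_le_mul_of_nonneg_right this hm0
      have h3 : e * t * m ≤ d * f * t := by
        calc e * t * m = e * m * t := by ring
          _ ≤ d * f * t := mul_le_mul_of_nonneg_right hsep ht
      have h4 : d * (g * m) ≤ d * (t * f) := by
        calc d * (g * m) = d * g * m := by ring
          _ ≤ d * f * t := h1.trans h3
          _ = d * (t * f) := by ring
      exact le_of_mul_le_mul_left h4 hdpos
  -- disjointness of the events `{o ↔ x} ∩ M`
  have h3 : ∑ x ∈ A, μ.real (openConn o x ∩ M) ≤ μ.real M := by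
    rw [← measureReal_biUnion_finset
      (singleFinger_pairwiseDisjoint_conn_inter_pairSep A A o (Finset.Subset.refl A))
      (fun x _ => MeasurableSet.of_discrete)]
    exact measureReal_mono (Set.iUnion₂_subset fun x _ => Set.inter_subset_right)
  have h4 : (∑ x ∈ A, μ.real (openConn o x ∩ {ω | ∀ t ∈ A.erase x, ω ∉ openConn x t} ∩ Q x)) *
      μ.real M ≤ t * μ.real M := by
    rw [Finset.sum_mul]
    calc ∑ x ∈ A, μ.real (openConn o x ∩ {ω | ∀ t ∈ A.erase x, ω ∉ openConn x t} ∩ Q x) * μ.real M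
        ≤ ∑ x ∈ A, t * μ.real (openConn o x ∩ M) := Finset.sum_le_sum h2
      _ = t * ∑ x ∈ A, μ.real (openConn o x ∩ M) := (Finset.mul_sum _ _ _).symm
      _ ≤ t * μ.real M := mul_le_mul_of_nonneg_left h3 ht
  exact le_of_mul_le_mul_right h4 hM

end GuardedLonelyRelay

open GuardedLonelyRelay in
/-- **The guarded lonely relay lemma (KN Lemma 1(ii) + Lemma 2), unconditional.**  For
`μ = prodBernoulli w` on `Fin n`, an observer `o`, a relay set `A`, increasing guards `Q_x` determined by the
cluster of `A ∖ x` (`1_{Q_x}(ω) = G_x(⋃_{t∈A∖x} C_t ω)`, `G_x` monotone), and `t ≥ 0` with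
`μ({x ↮ A∖x} ∩ Q_x) ≤ t` for every `x ∈ A`:
`Σ_{x∈A} μ({o ↔ x} ∩ {x ↮ A∖x} ∩ Q_x) ≤ t`.
[cite: KozmaNitzan2024, Lemmas 1–2 (pp. 5–6); VandenbergHaggstromKahn2005, Thms. 1.3, 1.5] -/
theorem guardedLonelyRelay (w : Sym2 (Fin n) → unitInterval) (A : Finset (Fin n)) (o : Fin n)
    (Q : Fin n → Set (BondConfig (Fin n)))
    (hQ : ∀ x ∈ A, ∃ G : Set (Sym2 (Fin n)) → ℝ, Monotone G ∧
      ∀ ω, G (⋃ t ∈ (↑(A.erase x) : Set (Fin n)), openEdgeCluster ω t) = (Q x).indicator 1 ω)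
    (t : ℝ) (ht : 0 ≤ t)
    (hq : ∀ x ∈ A, (prodBernoulli w).real ({ω | ∀ t ∈ A.erase x, ω ∉ openConn x t} ∩ Q x) ≤ t) :
    ∑ x ∈ A, (prodBernoulli w).real
        (openConn o x ∩ {ω | ∀ t ∈ A.erase x, ω ∉ openConn x t} ∩ Q x) ≤ t := by
  -- scaled weights `w_k = (1 - 1/(k+1)) • w`, all `< 1`, converging to `w`
  have hcmem : ∀ k : ℕ, ((1 : ℝ) - 1 / ((k : ℝ) + 1)) ∈ unitInterval := by
    intro k
    have hk : (0 : ℝ) < (k : ℝ) + 1 := Nat.cast_add_one_pos k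
    have h1 : 1 / ((k : ℝ) + 1) ≤ 1 := by
      rw [div_le_one hk]; linarith [(Nat.cast_nonneg k : (0 : ℝ) ≤ k)]
    have h0 : 0 ≤ 1 / ((k : ℝ) + 1) := by positivity
    exact ⟨by linarith, by linarith⟩
  set wk : ℕ → Sym2 (Fin n) → unitInterval :=
    fun k e => ⟨(1 - 1 / ((k : ℝ) + 1)) * (w e : ℝ), unitInterval.mul_mem (hcmem k) (w e).2⟩
    with hwk_def
  have hwk_lt : ∀ k e, ((wk k e : unitInterval) : ℝ) < 1 := by
    intro k e
    have hk : (0 : ℝ) < (k : ℝ) + 1 := Nat.cast_add_one_pos k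
    have hc : (1 : ℝ) - 1 / ((k : ℝ) + 1) < 1 := by
      have : 0 < 1 / ((k : ℝ) + 1) := by positivity
      linarith
    calc ((wk k e : unitInterval) : ℝ) = (1 - 1 / ((k : ℝ) + 1)) * (w e : ℝ) := rfl
      _ ≤ (1 - 1 / ((k : ℝ) + 1)) := mul_le_of_le_one_right (hcmem k).1 (w e).2.2
      _ < 1 := hc
  have hc_lim : Tendsto (fun k : ℕ => (1 : ℝ) - 1 / ((k : ℝ) + 1)) atTop (𝓝 1) := by
    simpa using tendsto_const_nhds.sub (tendsto_one_div_add_atTop_nhds_zero_nat (𝕜 := ℝ))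
  have hwk_lim : Tendsto wk atTop (𝓝 w) := by
    refine tendsto_pi_nhds.2 fun e => ?_
    rw [tendsto_subtype_rng]
    have h := hc_lim.mul_const (w e : ℝ)
    rw [one_mul] at h
    exact h
  have hlimE : ∀ E : Set (Set (Sym2 (Fin n))),
      Tendsto (fun k => (prodBernoulli (wk k)).real E) atTop (𝓝 ((prodBernoulli w).real E)) :=
    fun E => ((stub_weightContinuity n E).tendsto w).comp hwk_lim
  -- error terms
  set δ : ℕ → ℝ := fun k => ∑ x ∈ A,
      |(prodBernoulli (wk k)).real ({ω | ∀ t ∈ A.erase x, ω ∉ openConn x t} ∩ Q x) -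
        (prodBernoulli w).real ({ω | ∀ t ∈ A.erase x, ω ∉ openConn x t} ∩ Q x)| with hδ_def
  have hδ0 : ∀ k, 0 ≤ δ k := fun k => Finset.sum_nonneg fun x _ => abs_nonneg _
  have hδ_lim : Tendsto δ atTop (𝓝 0) := by
    have h : ∀ x ∈ A, Tendsto (fun k =>
        |(prodBernoulli (wk k)).real ({ω | ∀ t ∈ A.erase x, ω ∉ openConn x t} ∩ Q x) -
          (prodBernoulli w).real ({ω | ∀ t ∈ A.erase x, ω ∉ openConn x t} ∩ Q x)|) atTop (𝓝 0) := by
      intro x _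
      simpa using (tendsto_sub_nhds_zero_iff.2
        (hlimE ({ω | ∀ t ∈ A.erase x, ω ∉ openConn x t} ∩ Q x))).abs
    simpa [hδ_def] using tendsto_finsetSum A h
  -- the bound at each `k`
  have hk : ∀ k, ∑ x ∈ A, (prodBernoulli (wk k)).real
      (openConn o x ∩ {ω | ∀ t ∈ A.erase x, ω ∉ openConn x t} ∩ Q x) ≤ t + δ k := by
    intro k
    refine guardedLonelyRelay_of_pos (wk k) A o Q hQ (t + δ k) (by linarith [hδ0 k]) ?_ ?_
    · intro x hx
      have h1 := hq x hx
      have h2 : |(prodBernoulli (wk k)).real ({ω | ∀ t ∈ A.erase x, ω ∉ openConn x t} ∩ Q x) -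
            (prodBernoulli w).real ({ω | ∀ t ∈ A.erase x, ω ∉ openConn x t} ∩ Q x)| ≤ δ k :=
        Finset.single_le_sum (f := fun x =>
          |(prodBernoulli (wk k)).real ({ω | ∀ t ∈ A.erase x, ω ∉ openConn x t} ∩ Q x) -
            (prodBernoulli w).real ({ω | ∀ t ∈ A.erase x, ω ∉ openConn x t} ∩ Q x)|)
          (fun x _ => abs_nonneg _) hx
      have h3 := le_abs_self
        ((prodBernoulli (wk k)).real ({ω | ∀ t ∈ A.erase x, ω ∉ openConn x t} ∩ Q x) -
          (prodBernoulli w).real ({ω | ∀ t ∈ A.erase x, ω ∉ openConn x t} ∩ Q x))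
      linarith
    · exact singleFinger_pairSep_real_pos (wk k) (hwk_lt k) A
  -- pass to the limit
  have hlimS : Tendsto (fun k => ∑ x ∈ A, (prodBernoulli (wk k)).real
      (openConn o x ∩ {ω | ∀ t ∈ A.erase x, ω ∉ openConn x t} ∩ Q x)) atTop
      (𝓝 (∑ x ∈ A, (prodBernoulli w).real
        (openConn o x ∩ {ω | ∀ t ∈ A.erase x, ω ∉ openConn x t} ∩ Q x))) :=
    tendsto_finsetSum A fun x _ => hlimE _
  have hlimt : Tendsto (fun k => t + δ k) atTop (𝓝 t) := by
    simpa using tendsto_const_nhds.add hδ_lim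
  exact le_of_tendsto_of_tendsto' hlimS hlimt hk

end Summit.CriticalPhenomena.PercolationContinuityZ3.Theorems

end
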